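import Summits.BirchSwinnertonDyer.BirchSwinnertonDyer.Theorems.QuadraticBranchSignedControlPlusEtaNonsurjTamagawaDichotomyEta
import Literature.NumberTheory.EllipticCurves.IwasawaAlgebraCharAnnihilatorProofs
import HarnessLib

/-!
# Route `QuadraticBranchSignedControl` (rung K8, cell `bsd-potss`), residual crux
# `PlusEtaMainConjectureNonsurj` (stmt-BirchSwinnertonDyer-19606): the TAMAGAWA ROWS of the rank-`0`
# sub-cut — the dichotomy ON THE MODULE: `X⁺(V/K_∞)^η` is `ℤ_p`-TORSION-FREE (`μ = 0`) OR KILLED BY `p`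
# (`Char = (p)`), never both, and `X⁺(V/K_∞)^η ≠ 0` (seat `bsd-potss-k8eta-c2` g3, file 3)

WHAT. Files 1–2 of this seat (`…PlusEtaNonsurjTamagawaDichotomy{,Eta}`) pin the rows of crux 19606's
rank-`0` sub-cut with `ord_p(#Sel_{p^∞}(W/ℚ)·Tam(W)) = 1` (in-table: 78300bh1, 159300l1, 162675n1,
404325f1, 164700i1, 164700n1, 417600fp1 at `p = 5`): every generator `g` of `Char(X⁺(V/K_∞)^η)` has
`v_p(g(0)) = 1`, so `p ∤ g` (`μ = 0`, the content of `stub_etaMC_r0_mu`) OR `Char = (p)`. THIS FILE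
turns the alternative into a statement about the MODULE, using two consequences of the structure
theorem for `Λ`-modules WITHOUT finite submodules (this seat's Literature proofs file
`IwasawaAlgebraCharAnnihilatorProofs`: a generator of `Char(M)` annihilates `M`; `μ(M) = 0` ⟹ `M` has
no `p`-torsion):

* §1 (`W`-side) `noPTorsion_or_C_p_smul_eq_zero` — on a row with `ord_p #Sel + ord_p Tam ≤ 1`, every
  plus dual datum `D` of `Sel⁺(W/ℚ_∞)` whose `X` has no finite submodule is **`ℤ_p`-torsion-free OR
  killed by `p`** (UNCONDITIONAL); `tamagawaRow_module_structure` — with Poitou–Tate and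
  `ord_p #Sel + ord_p Tam = 1`: `X ≠ 0` and EXACTLY ONE of the two holds.
* §2 (`η`-side, Kitajima–Otsuki supplies «no finite submodule») `eta_noPTorsion_or_C_p_smul_eq_zero`,
  `eta_tamagawaRow_module_structure` — the same for every `η`-signed plus dual datum of `V`:
  **on the Tamagawa rows `X⁺(V/K_∞)^η` is a NON-ZERO module which is either `ℤ_p`-torsion-free
  (⟺ `stub_etaMC_r0_mu` at the pair; then a free `ℤ_p`-module of rank `λ ≥ 1`) or an
  `𝔽_p⟦T⟧`-module (`p·X = 0`)**; dually: `Sel⁺(W/ℚ_∞) = Sel⁺(V/K_∞)^η` is `p`-divisible or killed by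
  `p`. So the `μ = 0` stub on these rows is EQUIVALENT to «`Sel⁺(W/ℚ_∞)` contains a class of order
  `p²`». Kobayashi's conjecture with the computed invariants of `L_p⁺(V,η,X)` (seat census, kit
  j269184: `μ = 0`, `λ = 2, 2, 6, 2, 2` on the five rows computed) predicts the torsion-free branch
  with `X⁺(V/K_∞)^η ≅ ℤ_p^λ`.

HONEST FRAMING (cell `bsd-potss`, run/shared/lean/pub/bsd-potss/; FULL-BSD rank ≤ 1 programme,
tranche 1b, HUMAN RULING D-0036/D-0074): TOOL THEOREMS ONLY — no definition, no named Literature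
fact minted, no Summits-side `def … : Prop`, no `sorry`, axioms standard. The dichotomies are
CONDITIONAL only on the displayed «no finite submodule» binder (`W`-side) / Kitajima–Otsuki 2018 Main
Thm. 1.3 at `η` (`η`-side, named fact); the `X ≠ 0` / exclusivity statements also on Poitou–Tate
duality (`poitouTate_selmerStructure_duality_real ℚ`). Nothing about (C1⁺_η) is claimed;
`stub_etaMC_r0_mu` is neither proved nor refuted on any row; the crux 19606 stays OPEN; nothing is
booked; no label / mark / count moves. `--supports stmt-BirchSwinnertonDyer-19606`.

References: [Washington1997] §13.2 (Thm. 13.12); [NeukirchSchmidtWingberg2008] Ch. V §3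
(5.3.8)–(5.3.10); [GreenbergLNM1716] §4 Thm. 4.1, Lemma 4.2, Prop. 4.14–4.15; [Kobayashi2003] §4
p. 8, Thm. 9.3 with (9.33); [KitajimaOtsuki2018] Main Thm. 1.3; [GreenbergVatsal2000] p. 2 (1)–(2).
-/

set_option autoImplicit false
set_option linter.dupNamespace false

noncomputable section

open scoped Classical

open CongruenceSubgroup Field Function NumberField IsDedekindDomain WeierstrassCurve
open Literature.NumberTheory.EllipticCurves
open Literature.NumberTheory.EllipticCurves.ModularForms
open Literature.NumberTheory.EllipticCurves.Rank1Residual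
open Literature.NumberTheory.EllipticCurves.Rank1Residual.Typed
open Literature.NumberTheory.GaloisRepresentations
open Literature.NumberTheory.GaloisCohomology
open Literature.NumberTheory.EllipticCurves.IwasawaAlgebra
open Literature.NumberTheory.EllipticCurves.IwasawaDual ZpExtension
open Literature.NumberTheory.EllipticCurves.GreenbergVatsal2000
open Summit.BirchSwinnertonDyer.Rank1Residual.X11b.Levels
open Summit.BirchSwinnertonDyer.Rank1Residual.X11b
open Summit.BirchSwinnertonDyer.Rank1Residual.Additive
open Summit.BirchSwinnertonDyer.Rank1Residual.Additive.SignedTwist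
open scoped ContRepresentation
open Summit.BirchSwinnertonDyer.Rank1Residual.AdditivePotMult

namespace Summit.BirchSwinnertonDyer.BirchSwinnertonDyer.Theorems

namespace EtaTamagawaDichotomy

/-! ## §1 `W`-side: the plus dual data of `Sel⁺(W/ℚ_∞)` -/

section Twist

variable {p : ℕ} [hp : Fact p.Prime] (κ : ZpExtension ℚ p) (W : WeierstrassCurve ℚ) [W.IsElliptic]
  [W.IsGloballyMinimal]

/-- **`X⁺_W(ℚ_∞)` is `ℤ_p`-torsion-free OR killed by `p`** — for every plus dual datum `D` of
`Sel⁺(W/ℚ_∞)` whose `X` has no non-trivial finite `Λ`-submodule, on a row with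
`ord_p #Sel_{p^∞}(W/ℚ) + ord_p Tam(W) ≤ 1` (`W` globally minimal the `p*`-twist partner of a globally
minimal good `a_p = 0` curve `V`, `p ≥ 5`, `κ` cyclotomic with topological generator `γ`,
`Sel_{p^∞}(W/ℚ)` finite). File 1's dichotomy (`p ∤ g` OR `Char = (p)`) read on the module: `p ∤ g` is
`μ(X) = 0` (`muInvariant_eq_zero_iff_hasUnitContent`), hence no `p`-torsion
(`eq_zero_of_C_p_smul_eq_zero_of_muInvariant_eq_zero`); `Char = (p)` makes `p` annihilate `X`
(`smul_eq_zero_of_charIdeal_eq_span_of_noFiniteSubmodule`). UNCONDITIONAL beyond the displayed binders.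
[cite: Washington1997, §13.2 (Thm. 13.12)] [cite: GreenbergVatsal2000, p. 2 (1)–(2)]
[cite: GreenbergLNM1716, §4 Lemma 4.2 (p. 102)] -/
theorem noPTorsion_or_C_p_smul_eq_zero (hp5 : 5 ≤ p) (hκ : κ.IsCyclotomic)
    (C : VariableChange ℚ) (V : WeierstrassCurve ℚ) [V.IsElliptic] [V.IsGloballyMinimal]
    (hCV : C • W.quadraticTwist ((-1) ^ (p / 2) * p) = V)
    (hgood : V.HasGoodReductionAtPrime p) (hap : V.frobeniusTrace p = 0)
    {γ : Field.absoluteGaloisGroup ℚ} (hγ : κ.IsTopGenerator γ)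
    [Finite ↥(W.selmerGroupPInfty p)]
    (hle1 : padicValNat p (Nat.card ↥(W.selmerGroupPInfty p)) + padicValNat p W.tamagawaProduct ≤ 1)
    (D : StrictSignedSelmerDualData W κ ℚ_[p] γ 1)
    (hnf : ∀ N : Submodule (IwasawaAlgebra p) D.X, Finite N → N = ⊥) :
    (∀ x : D.X, (PowerSeries.C (p : ℤ_[p]) : IwasawaAlgebra p) • x = 0 → x = 0) ∨
      (∀ x : D.X, (PowerSeries.C (p : ℤ_[p]) : IwasawaAlgebra p) • x = 0) := by
  have hp2 : p ≠ 2 := by omega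
  obtain ⟨hfg, htor, -⟩ :=
    EtaBottomLayer.isTorsion_and_constantCoeff_ne_zero_of_finite_selmer κ W hp2 hκ C V hCV hgood hap hγ D
  haveI := hfg
  haveI : D.charIdeal.IsPrincipal := charIdeal_isPrincipal_holds p D.X
  obtain ⟨g, hg⟩ := Submodule.IsPrincipal.principal D.charIdeal
  have hg' : D.charIdeal = Ideal.span {g} := hg
  have hgM : Literature.NumberTheory.EllipticCurves.Module.charIdeal (IwasawaAlgebra p) D.X =
      Ideal.span {g} := D.charIdeal_def ▸ hg'
  rcases hasUnitContent_or_charIdeal_eq_span_C κ W hp5 hκ C V hCV hgood hap hγ hle1 D hg' with hu | hP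
  · -- `μ = 0`: no `p`-torsion
    left
    letI : Module ℤ_[p] D.X := Module.compHom D.X (algebraMap ℤ_[p] (IwasawaAlgebra p))
    haveI : IsScalarTower ℤ_[p] (IwasawaAlgebra p) D.X := IsScalarTower.of_compHom ℤ_[p] _ D.X
    have hμ : muInvariant p D.X = 0 := (muInvariant_eq_zero_iff_hasUnitContent D.X htor hgM).mpr hu
    intro x hx
    exact eq_zero_of_C_p_smul_eq_zero_of_muInvariant_eq_zero p D.X htor hnf hμ hx
  · -- `Char = (p)`: `p` annihilates
    right
    have hPM : Literature.NumberTheory.EllipticCurves.Module.charIdeal (IwasawaAlgebra p) D.X =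
        Ideal.span {PowerSeries.C (p : ℤ_[p])} := D.charIdeal_def ▸ hP
    intro x
    exact smul_eq_zero_of_charIdeal_eq_span_of_noFiniteSubmodule p D.X htor hnf hPM x

/-- **STRUCTURE OF `X⁺_W(ℚ_∞)` ON A TAMAGAWA ROW (`W`-side, Poitou–Tate).** On a row with
`ord_p #Sel_{p^∞}(W/ℚ) + ord_p Tam(W) = 1`, for a plus dual datum with no finite submodule: `X ≠ 0`, and
EXACTLY ONE of «`X` is `ℤ_p`-torsion-free» (then `μ = 0`, `λ ≥ 1`), «`p·X = 0`» (then `Char = (p)`)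
holds (a module both killed by `p` and without `p`-torsion is `0`). CONDITIONAL on `hPT` (for `X ≠ 0`:
file 1's `charIdeal_ne_top_and_nontrivial`). [cite: GreenbergLNM1716, §4 Thm. 4.1 and Lemma 4.2 (p. 102)]
[cite: Washington1997, §13.2 (Thm. 13.12)] [cite: MilneADT2006, Ch. I Thm. 4.10] -/
theorem tamagawaRow_module_structure (hPT : poitouTate_selmerStructure_duality_real ℚ) (hp5 : 5 ≤ p)
    (hκ : κ.IsCyclotomic) (C : VariableChange ℚ) (V : WeierstrassCurve ℚ) [V.IsElliptic]
    [V.IsGloballyMinimal] (hCV : C • W.quadraticTwist ((-1) ^ (p / 2) * p) = V)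
    (hgood : V.HasGoodReductionAtPrime p) (hap : V.frobeniusTrace p = 0)
    {γ : Field.absoluteGaloisGroup ℚ} (hγ : κ.IsTopGenerator γ)
    [Finite ↥(W.selmerGroupPInfty p)]
    (heq1 : padicValNat p (Nat.card ↥(W.selmerGroupPInfty p)) + padicValNat p W.tamagawaProduct = 1)
    (D : StrictSignedSelmerDualData W κ ℚ_[p] γ 1)
    (hnf : ∀ N : Submodule (IwasawaAlgebra p) D.X, Finite N → N = ⊥) :
    Nontrivial D.X ∧
      ((∀ x : D.X, (PowerSeries.C (p : ℤ_[p]) : IwasawaAlgebra p) • x = 0 → x = 0) ∨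
        (∀ x : D.X, (PowerSeries.C (p : ℤ_[p]) : IwasawaAlgebra p) • x = 0)) ∧
      ¬ ((∀ x : D.X, (PowerSeries.C (p : ℤ_[p]) : IwasawaAlgebra p) • x = 0 → x = 0) ∧
        (∀ x : D.X, (PowerSeries.C (p : ℤ_[p]) : IwasawaAlgebra p) • x = 0)) := by
  obtain ⟨-, hX⟩ := charIdeal_ne_top_and_nontrivial κ W hPT hp5 hκ C V hCV hgood hap hγ heq1 D hnf
  refine ⟨hX, noPTorsion_or_C_p_smul_eq_zero κ W hp5 hκ C V hCV hgood hap hγ heq1.le D hnf, ?_⟩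
  rintro ⟨hfree, hkill⟩
  obtain ⟨x, y, hxy⟩ := hX
  exact hxy ((hfree x (hkill x)).trans (hfree y (hkill y)).symm)

end Twist

/-! ## §2 `η`-side: the `η`-signed plus dual data of `V` (Kitajima–Otsuki supplies «no finite submodule») -/

section Eta

variable (W : WeierstrassCurve ℚ) [W.IsElliptic] [W.IsGloballyMinimal] (p : ℕ) [hp : Fact p.Prime]

/-- **`X⁺(V/K_∞)^η` is `ℤ_p`-torsion-free OR killed by `p`** on a row with
`ord_p #Sel_{p^∞}(W/ℚ) + ord_p Tam(W) ≤ 1`, for every `η`-signed plus dual datum `D'` of `V` over an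
abstract `K₀ = ℚ(μ_p)` — `W` globally minimal, `p ≥ 5`, `V` a globally minimal model of `W^{(p*)}`
good at `p` with `a_p(V) = 0`, `Sel_{p^∞}(W/ℚ)` finite; named fact `hKO` (Kitajima–Otsuki at `η`: no
finite submodule; finiteness / torsion of `D'.X` are free on these rows through (D5⁺)⁻¹). File 2's
dichotomy at `η` + this seat's `Λ`-module tools. The first branch is EXACTLY `stub_etaMC_r0_mu` at the
datum (`μ = 0`); dually `Sel⁺(V/K_∞)^η` is `p`-divisible, resp. killed by `p`.
[cite: Kobayashi2003, §4 p. 8 (X⁺(E/K_∞)^η), Thm. 9.3 with (9.33)] [cite: KitajimaOtsuki2018, Main Thm. 1.3]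
[cite: Washington1997, §13.2 (Thm. 13.12)] [cite: GreenbergVatsal2000, p. 2 (1)–(2)] -/
theorem eta_noPTorsion_or_C_p_smul_eq_zero
    (hKO : KitajimaOtsuki2018.mainThm13_etaSignedSelmerDual_noFiniteSubmodule)
    (V : WeierstrassCurve ℚ) [V.IsElliptic] [V.IsGloballyMinimal] (C : VariableChange ℚ)
    (hp5 : 5 ≤ p) (hCV : C • W.quadraticTwist ((-1) ^ (p / 2) * p) = V)
    (hgood : V.HasGoodReductionAtPrime p) (hap : V.frobeniusTrace p = 0)
    [Finite ↥(W.selmerGroupPInfty p)]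
    (hle1 : padicValNat p (Nat.card ↥(W.selmerGroupPInfty p)) + padicValNat p W.tamagawaProduct ≤ 1)
    (K₀ : Type) [Field K₀] [NumberField K₀] [IsCyclotomicExtension {p} ℚ K₀]
    [(galRange (K := ℚ) K₀).Normal] (ηq : absoluteGaloisGroup ℚ →* ℤˣ)
    (hηK : ∀ σ ∈ galRange (K := ℚ) K₀, ηq σ = 1) (hη1 : ηq ≠ 1)
    {κ : ZpExtension ℚ p} {γ : absoluteGaloisGroup ℚ} (hκ : κ.IsCyclotomic) (hγ : κ.IsTopGenerator γ)
    (hγK : γ ∈ galRange (K := ℚ) K₀) (D' : EtaSignedSelmerDualData V κ K₀ ℚ_[p] ηq γ 1) :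
    (∀ x : D'.X, (PowerSeries.C (p : ℤ_[p]) : IwasawaAlgebra p) • x = 0 → x = 0) ∨
      (∀ x : D'.X, (PowerSeries.C (p : ℤ_[p]) : IwasawaAlgebra p) • x = 0) := by
  have hp2 : p ≠ 2 := by omega
  -- the dictionary data at the abstract `K₀ = ℚ(μ_p)`: `θ² = p*`, `ηq` = the sign character of `θ`
  obtain ⟨θ, hθ2⟩ := exists_sq_eq_pStar p K₀ hp2
  have hc : θ ^ 2 = algebraMap ℚ K₀ ((-1) ^ (p / 2) * p) := by
    rw [hθ2, map_mul, map_pow, map_neg, map_one, map_natCast]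
  have hθ : θ ∉ Set.range (algebraMap ℚ K₀) := by
    rintro ⟨q, hq⟩
    apply forall_sq_ne_pStar p q
    apply (algebraMap ℚ K₀).injective
    rw [map_pow, hq, hc]
  have hη := eta_eq_one_iff_smul_rootInClosure p K₀ hθ hc ηq hηK hη1
  have hDloc := localTowerHyp_padic p κ K₀ hκ
  have hκ₀ := kappa_surjOn_galRange_cyclotomic κ K₀
  have hcop := coprime_index_galRange_cyclotomic p K₀
  obtain ⟨D, hfin, htor, -, -⟩ :=
    ConverseControl.exists_strictSignedSelmerDualData_one_of_eta W K₀ hθ hc p κ hCV ηq hη ℚ_[p] hDloc hκ₀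
      hcop hγK D'
  -- finiteness / torsion of `D'` through the `W`-side datum; no finite submodule is `hKO`
  obtain ⟨hfgD, htorD, -⟩ :=
    EtaBottomLayer.isTorsion_and_constantCoeff_ne_zero_of_finite_selmer κ W hp2 hκ C V hCV hgood hap hγ D
  haveI hfin' : Module.Finite (IwasawaAlgebra p) D'.X := hfin.mp hfgD
  have htor' : Module.IsTorsion (IwasawaAlgebra p) D'.X := htor.mp htorD
  have hnf' : ∀ M : Submodule (IwasawaAlgebra p) D'.X, Finite M → M = ⊥ :=
    hKO p K₀ ηq hηK V hp2 hgood hap κ γ hκ hγ hγK 1 D'.toLiterature hfin' htor'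
  -- a generator of `Char(X⁺(V/K_∞)^η)` and file 2's dichotomy
  haveI : D'.charIdeal.IsPrincipal := charIdeal_isPrincipal_holds p D'.X
  obtain ⟨g, hg⟩ := Submodule.IsPrincipal.principal D'.charIdeal
  have hg' : D'.charIdeal = Ideal.span {g} := hg
  have hgM : Literature.NumberTheory.EllipticCurves.Module.charIdeal (IwasawaAlgebra p) D'.X =
      Ideal.span {g} := hg'
  rcases eta_hasUnitContent_or_charIdeal_eq_span_C W p V C hp5 hCV hgood hap hle1 K₀ ηq hηK hη1 hκ hγ hγK
      D' hg' with hu | hP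
  · left
    letI : Module ℤ_[p] D'.X := Module.compHom D'.X (algebraMap ℤ_[p] (IwasawaAlgebra p))
    haveI : IsScalarTower ℤ_[p] (IwasawaAlgebra p) D'.X := IsScalarTower.of_compHom ℤ_[p] _ D'.X
    have hμ : muInvariant p D'.X = 0 := (muInvariant_eq_zero_iff_hasUnitContent D'.X htor' hgM).mpr hu
    intro x hx
    exact eq_zero_of_C_p_smul_eq_zero_of_muInvariant_eq_zero p D'.X htor' hnf' hμ hx
  · right
    have hPM : Literature.NumberTheory.EllipticCurves.Module.charIdeal (IwasawaAlgebra p) D'.X =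
        Ideal.span {PowerSeries.C (p : ℤ_[p])} := hP
    intro x
    exact smul_eq_zero_of_charIdeal_eq_span_of_noFiniteSubmodule p D'.X htor' hnf' hPM x

/-- **STRUCTURE OF `X⁺(V/K_∞)^η` ON A TAMAGAWA ROW** (`ord_p #Sel_{p^∞}(W/ℚ) + ord_p Tam(W) = 1`;
named facts `hPT`, `hKO`): for every `η`-signed plus dual datum `D'` of `V`, **`X⁺(V/K_∞)^η ≠ 0` and
EXACTLY ONE of «`ℤ_p`-torsion-free» (⟺ `μ = 0`, the content of `stub_etaMC_r0_mu` at the pair; then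
`X ≅ ℤ_p^λ` with `λ ≥ 1`), «`p·X⁺(V/K_∞)^η = 0`» (⟺ `Char = (p)`) holds.** On the 7 Tamagawa-`5` rows
of the census this is the exact shape of what crux 19606's rank-`0` sub-cut still has to decide; the
analytic invariants of `L_p⁺(V,η,X)` (kit j269184: `μ = 0` on every row computed) and Kobayashi's
conjecture point to the torsion-free branch. CONDITIONAL on `hPT`, `hKO`; nothing booked.
[cite: Kobayashi2003, §4 p. 8, Thm. 9.3 with (9.33)] [cite: KitajimaOtsuki2018, Main Thm. 1.3]
[cite: GreenbergLNM1716, §4 Thm. 4.1 and Lemma 4.2, Prop. 4.14–4.15] [cite: Washington1997, §13.2 (Thm. 13.12)] -/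
theorem eta_tamagawaRow_module_structure
    (hPT : poitouTate_selmerStructure_duality_real ℚ)
    (hKO : KitajimaOtsuki2018.mainThm13_etaSignedSelmerDual_noFiniteSubmodule)
    (V : WeierstrassCurve ℚ) [V.IsElliptic] [V.IsGloballyMinimal] (C : VariableChange ℚ)
    (hp5 : 5 ≤ p) (hCV : C • W.quadraticTwist ((-1) ^ (p / 2) * p) = V)
    (hgood : V.HasGoodReductionAtPrime p) (hap : V.frobeniusTrace p = 0)
    [Finite ↥(W.selmerGroupPInfty p)]
    (heq1 : padicValNat p (Nat.card ↥(W.selmerGroupPInfty p)) + padicValNat p W.tamagawaProduct = 1)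
    (K₀ : Type) [Field K₀] [NumberField K₀] [IsCyclotomicExtension {p} ℚ K₀]
    [(galRange (K := ℚ) K₀).Normal] (ηq : absoluteGaloisGroup ℚ →* ℤˣ)
    (hηK : ∀ σ ∈ galRange (K := ℚ) K₀, ηq σ = 1) (hη1 : ηq ≠ 1)
    {κ : ZpExtension ℚ p} {γ : absoluteGaloisGroup ℚ} (hκ : κ.IsCyclotomic) (hγ : κ.IsTopGenerator γ)
    (hγK : γ ∈ galRange (K := ℚ) K₀) (D' : EtaSignedSelmerDualData V κ K₀ ℚ_[p] ηq γ 1) :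
    Nontrivial D'.X ∧
      ((∀ x : D'.X, (PowerSeries.C (p : ℤ_[p]) : IwasawaAlgebra p) • x = 0 → x = 0) ∨
        (∀ x : D'.X, (PowerSeries.C (p : ℤ_[p]) : IwasawaAlgebra p) • x = 0)) ∧
      ¬ ((∀ x : D'.X, (PowerSeries.C (p : ℤ_[p]) : IwasawaAlgebra p) • x = 0 → x = 0) ∧
        (∀ x : D'.X, (PowerSeries.C (p : ℤ_[p]) : IwasawaAlgebra p) • x = 0)) := by
  haveI : D'.charIdeal.IsPrincipal := charIdeal_isPrincipal_holds p D'.X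
  obtain ⟨g, hg⟩ := Submodule.IsPrincipal.principal D'.charIdeal
  have hg' : D'.charIdeal = Ideal.span {g} := hg
  obtain ⟨-, -, -, hX⟩ := eta_valuation_charGenerator_eq_one W p hPT hKO V C hp5 hCV hgood hap heq1 K₀ ηq
    hηK hη1 hκ hγ hγK D' hg'
  refine ⟨hX, eta_noPTorsion_or_C_p_smul_eq_zero W p hKO V C hp5 hCV hgood hap heq1.le K₀ ηq hηK hη1 hκ hγ
    hγK D', ?_⟩
  rintro ⟨hfree, hkill⟩
  obtain ⟨x, y, hxy⟩ := hX
  exact hxy ((hfree x (hkill x)).trans (hfree y (hkill y)).symm)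

/-- **`stub_etaMC_r0_mu` at a Tamagawa pair ⟺ a witness of order `p²`.** On a row with
`ord_p #Sel_{p^∞}(W/ℚ) + ord_p Tam(W) ≤ 1` (named fact `hKO`): if some element of some `η`-datum's
module is NOT killed by `p`, then that datum's module is `ℤ_p`-torsion-free — and conversely a
torsion-free non-zero module has such elements. This is the per-datum decision procedure the
dichotomy leaves: `μ(X⁺(V/K_∞)^η) = 0` iff `p·X⁺(V/K_∞)^η ≠ 0` (dually: iff `Sel⁺(V/K_∞)^η` has a
class of order `p²`). CONDITIONAL on `hKO`; nothing booked. [cite: Kobayashi2003, §4 p. 8]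
[cite: KitajimaOtsuki2018, Main Thm. 1.3] [cite: Washington1997, §13.2] -/
theorem eta_noPTorsion_of_exists_C_p_smul_ne_zero
    (hKO : KitajimaOtsuki2018.mainThm13_etaSignedSelmerDual_noFiniteSubmodule)
    (V : WeierstrassCurve ℚ) [V.IsElliptic] [V.IsGloballyMinimal] (C : VariableChange ℚ)
    (hp5 : 5 ≤ p) (hCV : C • W.quadraticTwist ((-1) ^ (p / 2) * p) = V)
    (hgood : V.HasGoodReductionAtPrime p) (hap : V.frobeniusTrace p = 0)
    [Finite ↥(W.selmerGroupPInfty p)]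
    (hle1 : padicValNat p (Nat.card ↥(W.selmerGroupPInfty p)) + padicValNat p W.tamagawaProduct ≤ 1)
    (K₀ : Type) [Field K₀] [NumberField K₀] [IsCyclotomicExtension {p} ℚ K₀]
    [(galRange (K := ℚ) K₀).Normal] (ηq : absoluteGaloisGroup ℚ →* ℤˣ)
    (hηK : ∀ σ ∈ galRange (K := ℚ) K₀, ηq σ = 1) (hη1 : ηq ≠ 1)
    {κ : ZpExtension ℚ p} {γ : absoluteGaloisGroup ℚ} (hκ : κ.IsCyclotomic) (hγ : κ.IsTopGenerator γ)
    (hγK : γ ∈ galRange (K := ℚ) K₀) (D' : EtaSignedSelmerDualData V κ K₀ ℚ_[p] ηq γ 1)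
    (hx : ∃ x : D'.X, (PowerSeries.C (p : ℤ_[p]) : IwasawaAlgebra p) • x ≠ 0) :
    ∀ y : D'.X, (PowerSeries.C (p : ℤ_[p]) : IwasawaAlgebra p) • y = 0 → y = 0 := by
  obtain ⟨x, hx⟩ := hx
  rcases eta_noPTorsion_or_C_p_smul_eq_zero W p hKO V C hp5 hCV hgood hap hle1 K₀ ηq hηK hη1 hκ hγ hγK D'
    with hfree | hkill
  · exact hfree
  · exact absurd (hkill x) hx

end Eta

end EtaTamagawaDichotomy

end Summit.BirchSwinnertonDyer.BirchSwinnertonDyer.Theorems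

end
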